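import Literature.AlgebraicGeometry.HodgeTheory.NoTypeIVFactorProducts
import Literature.AlgebraicGeometry.Motives.AbelianVarietyKernelComponent
import HarnessLib

/-!
# `End⁰(A × B) = End⁰(A) × End⁰(B)` for `Hom(A, B) = 0 = Hom(B, A)` (Mumford §19 Cor. 2; Lange Cor. 2.4.26), on `A.prod B` with explicit corners; the converse `HasNoTypeIVFactor (A × B) → HasNoTypeIVFactor A ∧ HasNoTypeIVFactor B` for orthogonal, in particular for simple non-isogenous, factors

Family `hodge`, layer `Literature/AlgebraicGeometry/HodgeTheory`. Research context: cell `pub-hodge-ring2`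
(HONEST FRAMING: research route conditional on HC_CM; not a corollary; Q11.4-sentence-2 already refuted in
dim ≥ 3), Literature lane; UNCONDITIONAL structure of endomorphism algebras; sequel of
`NoTypeIVFactorProducts` (there: the centre of `End⁰(A × B)` embeds in `Z(End⁰ A) × Z(End⁰ B)` and
`HasNoTypeIVFactor` is stable under `A.prod B`, powers and isogeny, with NO hypothesis on `Hom(A, B)`).

PUBLISHED STATEMENT. Lange, *Abelian Varieties over the Complex Numbers* (2023), proof of Cor. 2.4.26 (held
`book:lange1992-complex-abelian-varieties` chunk p0124): «Since `Hom(X_ν^{n_ν}, X_μ^{n_μ}) = 0` for `ν ≠ μ`,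
we obtain `End_ℚ(X) = ⊕_ν End_ℚ(X_ν^{n_ν})`»; Mumford, *Abelian Varieties*, §19 Cor. 2 p. 174
(`End⁰(X) = ⊕ M_{nᵢ}(Dᵢ)` for `X ∼ ∏ Xᵢ^{nᵢ}` with the `Xᵢ` simple pairwise non-isogenous — the first
step being exactly the vanishing of the cross terms); a non-zero homomorphism between SIMPLE abelian
varieties is an isogeny (Mumford §19 Cor. 2 of Thm. 1; the tree's `AbelianVariety.hsimple_of_isAlgClosed`).
The tree has the `Fintype`-indexed biproduct version `AbelianVariety.nonempty_algEquiv_endAlgebra_biproduct_pi`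
(`Motives/AbelianVarietyEndAlgebraOrthogonalBiproduct`, an existential `≃ₐ`); this file gives the BINARY
version on `A.prod B` with the EXPLICIT corner maps `fstAlg`, `sndAlg`, `prodEndAlgebraHom` of
`Milne1999/CMTypeProducts`, which is the form the corner calculus of `NoTypeIVFactorProducts` and the
cell's product lane use.

MAIN RESULTS (all proved; theorems only; no named fact, D-0026). Under ORTHOGONALITY
`hAB : ∀ f : A ⟶ B, f = 0`, `hBA : ∀ g : B ⟶ A, g = 0`:
* `NoTypeIVFactorProducts.eq_inlEnd_add_inrEnd_of_orthogonal` — every `h ∈ End(A × B)` is block-diagonal,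
  `h = diag(corner₁ h, 0) + diag(0, corner₂ h)` (Mathlib `Biprod.ofComponents_eq` with zero cross components);
* `NoTypeIVFactorProducts.eq_prodEndAlgebraHom_of_orthogonal` — every `w ∈ End⁰(A × B)` is
  `prodEndAlgebraHom (corner₁ w, corner₂ w)`; `prodEndAlgebraHom_bijective_of_orthogonal`
  (`End⁰(A) × End⁰(B) ≃ End⁰(A × B)`); `fstAlg_mul_of_orthogonal` / `sndAlg_mul_of_orthogonal` (the corners
  are multiplicative);
* `NoTypeIVFactorProducts.prodEndAlgebraHom_mem_center_of_orthogonal` — `diag(a, b)` is central for central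
  `a`, `b` (so `Z(End⁰(A × B)) = Z(End⁰ A) × Z(End⁰ B)` with `eq_prodEndAlgebraHom_of_mem_center`);
* `HasNoTypeIVFactor.left_of_orthogonal` / `.right_of_orthogonal`, `hasNoTypeIVFactor_prod_iff_of_orthogonal`:
  **`HasNoTypeIVFactor (A.prod B) ↔ HasNoTypeIVFactor A ∧ HasNoTypeIVFactor B`**;
* `orthogonal_of_isSimple_of_not_isIsogenous₂` and `hasNoTypeIVFactor_prod_iff_of_isSimple_of_not_isIsogenous`:
  the same for `A`, `B` simple and non-isogenous (over `ℂ`; `hsimple_of_isAlgClosed`, `IsIsogenous.symm'`).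

## References

* [MumfordAV1970] D. Mumford, *Abelian Varieties*, §19 Cor. 2 (p. 174) and Cor. 2 of Thm. 1.
  [cite: MumfordAV1970, §19 Cor. 2 (p. 174)]
* [Lange2023AbelianVarietiesC] H. Lange, *Abelian Varieties over the Complex Numbers* (2023), Thm. 2.4.25,
  Cor. 2.4.26 and its proof (held as `book:lange1992-complex-abelian-varieties`, chunks 123–124).
  [cite: Lange2023AbelianVarietiesC, proof of Cor. 2.4.26]
* [MoonenZarhin1999LowDim] B. Moonen, Yu. Zarhin, Math. Ann. 315 (1999), §1 (no factors of Type 4).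
  [cite: MoonenZarhin1999LowDim, §1 and Thm. (3.2)]
-/

noncomputable section

open CategoryTheory CategoryTheory.Limits Polynomial

namespace Literature.AlgebraicGeometry.HodgeTheory

open Literature.AlgebraicGeometry.Motives
open Literature.AlgebraicGeometry.Milne1999.CMTypeProducts

namespace NoTypeIVFactorProducts

variable {A B : AbelianVariety ℂ}

/-! ### §1 Orthogonal factors: every endomorphism of `A × B` is block-diagonal -/

section EndLevel

/-- On `A ⊞ B`: a morphism with zero cross components is `biprod.map` of its diagonal components
(`Biprod.ofComponents_eq`). [cite: Lange2023AbelianVarietiesC, proof of Cor. 2.4.26] -/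
private theorem biprod_eq_map_of_cross_eq_zero (w : A ⊞ B ⟶ A ⊞ B)
    (h₁₂ : biprod.inl ≫ w ≫ biprod.snd = 0) (h₂₁ : biprod.inr ≫ w ≫ biprod.fst = 0) :
    w = biprod.map (biprod.inl ≫ w ≫ biprod.fst) (biprod.inr ≫ w ≫ biprod.snd) := by
  apply biprod.hom_ext' <;> apply biprod.hom_ext <;> simp [Category.assoc, h₁₂, h₂₁]

/-- **Block-diagonality under orthogonality** («Since `Hom(X_ν, X_μ) = 0` for `ν ≠ μ` we obtain
`End(X) = ⊕ End(X_ν)`»): if `Hom(A, B) = 0` and `Hom(B, A) = 0`, every `h ∈ End(A × B)` equals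
`diag(corner₁ h, 0) + diag(0, corner₂ h)`. [cite: Lange2023AbelianVarietiesC, proof of Cor. 2.4.26]
[cite: MumfordAV1970, §19 Cor. 2 (p. 174)] -/
theorem eq_inlEnd_add_inrEnd_of_orthogonal (hAB : ∀ f : A ⟶ B, f = 0) (hBA : ∀ g : B ⟶ A, g = 0)
    (h : End (A.prod B)) : h = inlEnd A B (fstEnd A B h) + inrEnd A B (sndEnd A B h) := by
  show h = blockDiag A B (cornerFst A B h) 0 + blockDiag A B 0 (cornerSnd A B h)
  rw [← blockDiag_add, add_zero, zero_add]
  have hw := biprod_eq_map_of_cross_eq_zero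
    ((AbelianVariety.biprodIsoProd A B).hom ≫ h ≫ (AbelianVariety.biprodIsoProd A B).inv) (hAB _) (hBA _)
  simp only [Category.assoc] at hw
  simp only [blockDiag, cornerFst, cornerSnd]
  rw [← hw]
  simp only [Category.assoc, Iso.inv_hom_id_assoc, Iso.inv_hom_id, Category.comp_id]

end EndLevel

/-! ### §2 `End⁰(A × B) = End⁰(A) × End⁰(B)` for orthogonal factors -/

section TensorLevel

open AbelianVariety

/-- **Every element of `End⁰(A × B)` is block-diagonal for orthogonal `A`, `B`**:
`w = prodEndAlgebraHom (corner₁ w, corner₂ w)`. [cite: Lange2023AbelianVarietiesC, proof of Cor. 2.4.26]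
[cite: MumfordAV1970, §19 Cor. 2 (p. 174)] -/
theorem eq_prodEndAlgebraHom_of_orthogonal (hAB : ∀ f : A ⟶ B, f = 0) (hBA : ∀ g : B ⟶ A, g = 0)
    (w : endAlgebra (A.prod B)) : w = prodEndAlgebraHom A B (fstAlg A B w, sndAlg A B w) := by
  simp only [prodEndAlgebraHom_apply, prodEndAlgebraMap_apply]
  obtain ⟨M, H, -, rfl⟩ := endAlgebra.exists_eq_algebraMap_mul_of w
  rw [fstAlg_gen, sndAlg_gen, inlAlg_gen, inrAlg_gen, ← mul_add, ← (endAlgebra.of (A.prod B)).map_add,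
    ← eq_inlEnd_add_inrEnd_of_orthogonal hAB hBA H]

/-- **`End⁰(A) × End⁰(B) → End⁰(A × B)` is BIJECTIVE for orthogonal factors** (injective always,
`prodEndAlgebraHom_injective`). [cite: Lange2023AbelianVarietiesC, proof of Cor. 2.4.26] [cite: MumfordAV1970, §19 Cor. 2 (p. 174)] -/
theorem prodEndAlgebraHom_bijective_of_orthogonal (hAB : ∀ f : A ⟶ B, f = 0)
    (hBA : ∀ g : B ⟶ A, g = 0) : Function.Bijective (prodEndAlgebraHom A B) :=
  ⟨prodEndAlgebraHom_injective, fun w => ⟨_, (eq_prodEndAlgebraHom_of_orthogonal hAB hBA w).symm⟩⟩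

/-- For orthogonal factors the upper-left corner is multiplicative on all of `End⁰(A × B)`.
[cite: Lange2023AbelianVarietiesC, proof of Cor. 2.4.26] -/
theorem fstAlg_mul_of_orthogonal (hAB : ∀ f : A ⟶ B, f = 0) (hBA : ∀ g : B ⟶ A, g = 0)
    (w w' : endAlgebra (A.prod B)) : fstAlg A B (w * w') = fstAlg A B w * fstAlg A B w' := by
  conv_lhs => rw [eq_prodEndAlgebraHom_of_orthogonal hAB hBA w, eq_prodEndAlgebraHom_of_orthogonal hAB hBA w',
    ← map_mul, prodEndAlgebraHom_apply, fstAlg_prodEndAlgebraMap, Prod.fst_mul]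

/-- For orthogonal factors the lower-right corner is multiplicative on all of `End⁰(A × B)`.
[cite: Lange2023AbelianVarietiesC, proof of Cor. 2.4.26] -/
theorem sndAlg_mul_of_orthogonal (hAB : ∀ f : A ⟶ B, f = 0) (hBA : ∀ g : B ⟶ A, g = 0)
    (w w' : endAlgebra (A.prod B)) : sndAlg A B (w * w') = sndAlg A B w * sndAlg A B w' := by
  conv_lhs => rw [eq_prodEndAlgebraHom_of_orthogonal hAB hBA w, eq_prodEndAlgebraHom_of_orthogonal hAB hBA w',
    ← map_mul, prodEndAlgebraHom_apply, sndAlg_prodEndAlgebraMap, Prod.snd_mul]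

/-- **`diag(a, b)` is central in `End⁰(A × B)` for central `a`, `b` and orthogonal factors** (then
`Z(End⁰(A × B)) = Z(End⁰ A) × Z(End⁰ B)`, Mumford §19 Cor. 2: `Z(⊕ M_{nᵢ}(Dᵢ)) = ∏ Z(Dᵢ)`).
[cite: MumfordAV1970, §19 Cor. 2 (p. 174)] -/
theorem prodEndAlgebraHom_mem_center_of_orthogonal (hAB : ∀ f : A ⟶ B, f = 0)
    (hBA : ∀ g : B ⟶ A, g = 0) {a : endAlgebra A} {b : endAlgebra B}
    (ha : a ∈ Subalgebra.center ℚ (endAlgebra A)) (hb : b ∈ Subalgebra.center ℚ (endAlgebra B)) :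
    prodEndAlgebraHom A B (a, b) ∈ Subalgebra.center ℚ (endAlgebra (A.prod B)) := by
  rw [Subalgebra.mem_center_iff] at ha hb ⊢
  intro w
  rw [eq_prodEndAlgebraHom_of_orthogonal hAB hBA w, ← map_mul, ← map_mul, Prod.mk_mul_mk, Prod.mk_mul_mk,
    ha, hb]

/-- The centre of `End⁰(A × B)` for orthogonal factors, elementwise: `w` is central iff its two corners are
central. [cite: MumfordAV1970, §19 Cor. 2 (p. 174)] -/
theorem mem_center_iff_of_orthogonal (hAB : ∀ f : A ⟶ B, f = 0) (hBA : ∀ g : B ⟶ A, g = 0)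
    (w : endAlgebra (A.prod B)) :
    w ∈ Subalgebra.center ℚ (endAlgebra (A.prod B)) ↔
      fstAlg A B w ∈ Subalgebra.center ℚ (endAlgebra A) ∧ sndAlg A B w ∈ Subalgebra.center ℚ (endAlgebra B) := by
  refine ⟨fun hw => ⟨fstAlg_mem_center hw, sndAlg_mem_center hw⟩, fun ⟨h₁, h₂⟩ => ?_⟩
  rw [eq_prodEndAlgebraHom_of_orthogonal hAB hBA w]
  exact prodEndAlgebraHom_mem_center_of_orthogonal hAB hBA h₁ h₂

/-- `aeval` on a pair is the pair of `aeval`s. [folklore] -/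
private theorem aeval_pair' {S T : Type*} [Ring S] [Ring T] [Algebra ℚ S] [Algebra ℚ T] (a : S) (b : T)
    (f : ℚ[X]) : aeval (a, b) f = (aeval a f, aeval b f) :=
  Prod.ext (by simpa using (aeval_algHom_apply (AlgHom.fst ℚ S T) (a, b) f).symm)
    (by simpa using (aeval_algHom_apply (AlgHom.snd ℚ S T) (a, b) f).symm)

end TensorLevel

end NoTypeIVFactorProducts

open NoTypeIVFactorProducts
open Literature.AlgebraicGeometry.Milne1999.CMTypeProducts

/-! ### §3 The converse: `HasNoTypeIVFactor (A × B) → HasNoTypeIVFactor A`, `HasNoTypeIVFactor B` for orthogonal factors -/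

/-- **No type-IV factor descends to an orthogonal factor**: if `Hom(A,B) = 0 = Hom(B,A)` and `A × B` has
no factor of type IV, neither has `A` — a central `a ∈ End⁰(A)` gives the central `diag(a, 0)`, and a
polynomial killing `diag(a, 0)` kills `a` (read the upper-left corner). In print: the simple factors of `A`
are among those of `A × B`. [cite: MoonenZarhin1999LowDim, §1 and Thm. (3.2)] [cite: MumfordAV1970, §19 Cor. 2 (p. 174)] -/
theorem HasNoTypeIVFactor.left_of_orthogonal {A B : AbelianVariety ℂ} (hAB : ∀ f : A ⟶ B, f = 0)
    (hBA : ∀ g : B ⟶ A, g = 0) (h : HasNoTypeIVFactor (A.prod B)) : HasNoTypeIVFactor A := by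
  intro a ha
  obtain ⟨f, hf0, hf, hfr⟩ := h _ (prodEndAlgebraHom_mem_center_of_orthogonal hAB hBA ha
    (Subalgebra.zero_mem _))
  refine ⟨f, hf0, ?_, hfr⟩
  rw [aeval_algHom_apply, aeval_pair', prodEndAlgebraHom_apply] at hf
  have h1 := congrArg (fstAlg A B) hf
  rwa [fstAlg_prodEndAlgebraMap, map_zero] at h1

/-- **No type-IV factor descends to the second orthogonal factor.** [cite: MoonenZarhin1999LowDim, §1 and Thm. (3.2)]
[cite: MumfordAV1970, §19 Cor. 2 (p. 174)] -/
theorem HasNoTypeIVFactor.right_of_orthogonal {A B : AbelianVariety ℂ} (hAB : ∀ f : A ⟶ B, f = 0)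
    (hBA : ∀ g : B ⟶ A, g = 0) (h : HasNoTypeIVFactor (A.prod B)) : HasNoTypeIVFactor B := by
  intro b hb
  obtain ⟨f, hf0, hf, hfr⟩ := h _ (prodEndAlgebraHom_mem_center_of_orthogonal hAB hBA
    (Subalgebra.zero_mem _) hb)
  refine ⟨f, hf0, ?_, hfr⟩
  rw [aeval_algHom_apply, aeval_pair', prodEndAlgebraHom_apply] at hf
  have h1 := congrArg (sndAlg A B) hf
  rwa [sndAlg_prodEndAlgebraMap, map_zero] at h1

/-- **`HasNoTypeIVFactor (A × B) ↔ HasNoTypeIVFactor A ∧ HasNoTypeIVFactor B` for orthogonal factors**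
(`←` holds without orthogonality: `HasNoTypeIVFactor.prod`). [cite: MoonenZarhin1999LowDim, §1 and Thm. (3.2)]
[cite: MumfordAV1970, §19 Cor. 2 (p. 174)] -/
theorem hasNoTypeIVFactor_prod_iff_of_orthogonal {A B : AbelianVariety ℂ} (hAB : ∀ f : A ⟶ B, f = 0)
    (hBA : ∀ g : B ⟶ A, g = 0) :
    HasNoTypeIVFactor (A.prod B) ↔ HasNoTypeIVFactor A ∧ HasNoTypeIVFactor B :=
  ⟨fun h => ⟨h.left_of_orthogonal hAB hBA, h.right_of_orthogonal hAB hBA⟩, fun h => h.1.prod h.2⟩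

/-! ### §4 Simple, non-isogenous factors -/

/-- **Simple non-isogenous complex abelian varieties are orthogonal**: `Hom(A, B) = 0` and `Hom(B, A) = 0`
(a non-zero homomorphism between simple abelian varieties is an isogeny, Mumford §19 Cor. 2 of Thm. 1 —
the tree's `hsimple_of_isAlgClosed`; isogeny is symmetric, `IsIsogenous.symm'`). The `Fintype`-indexed form
is the tree's `orthogonal_of_isSimple_of_not_isIsogenous`. [cite: MumfordAV1970, §19 Cor. 2 (p. 174)] -/
theorem orthogonal_of_isSimple_of_not_isIsogenous₂ {A B : AbelianVariety ℂ} (hA : A.IsSimple)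
    (hB : B.IsSimple) (hAB : ¬ AbelianVariety.IsIsogenous A B) :
    (∀ f : A ⟶ B, f = 0) ∧ ∀ g : B ⟶ A, g = 0 := by
  refine ⟨fun f => ?_, fun g => ?_⟩
  · by_contra hf
    exact hAB ⟨f, AbelianVariety.hsimple_of_isAlgClosed ℂ A B hA hB f hf⟩
  · by_contra hg
    exact hAB (AbelianVariety.IsIsogenous.symm' ⟨g, AbelianVariety.hsimple_of_isAlgClosed ℂ B A hB hA g hg⟩)

/-- **For simple non-isogenous `A`, `B`: `HasNoTypeIVFactor (A × B) ↔ HasNoTypeIVFactor A ∧ HasNoTypeIVFactor B`.**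
[cite: MoonenZarhin1999LowDim, §1 and Thm. (3.2)] [cite: MumfordAV1970, §19 Cor. 2 (p. 174)] -/
theorem hasNoTypeIVFactor_prod_iff_of_isSimple_of_not_isIsogenous {A B : AbelianVariety ℂ} (hA : A.IsSimple)
    (hB : B.IsSimple) (hAB : ¬ AbelianVariety.IsIsogenous A B) :
    HasNoTypeIVFactor (A.prod B) ↔ HasNoTypeIVFactor A ∧ HasNoTypeIVFactor B :=
  hasNoTypeIVFactor_prod_iff_of_orthogonal (orthogonal_of_isSimple_of_not_isIsogenous₂ hA hB hAB).1
    (orthogonal_of_isSimple_of_not_isIsogenous₂ hA hB hAB).2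

/-- **`End⁰(A × B) ≅ End⁰(A) × End⁰(B)` for simple non-isogenous `A`, `B`** (the block-diagonal algebra
homomorphism is bijective). [cite: Lange2023AbelianVarietiesC, proof of Cor. 2.4.26] [cite: MumfordAV1970, §19 Cor. 2 (p. 174)] -/
theorem prodEndAlgebraHom_bijective_of_isSimple_of_not_isIsogenous {A B : AbelianVariety ℂ} (hA : A.IsSimple)
    (hB : B.IsSimple) (hAB : ¬ AbelianVariety.IsIsogenous A B) :
    Function.Bijective (prodEndAlgebraHom A B) :=
  prodEndAlgebraHom_bijective_of_orthogonal (orthogonal_of_isSimple_of_not_isIsogenous₂ hA hB hAB).1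
    (orthogonal_of_isSimple_of_not_isIsogenous₂ hA hB hAB).2

end Literature.AlgebraicGeometry.HodgeTheory

end
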